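import Summits.Ventures.HodgeRepro2.T6N43BergmanToy
import Summits.Ventures.HodgeRepro2.T6N42ToyNSide
import Summits.Ventures.HodgeRepro2.T6N4Hyp

/-!
# T6N43BergmanNSide — the toy N4 side of the M2 v5 carrier (the t6-p5 × t6-p6 seam, README §10.5(ii)(d))

The lead's M2 v5 (`periodInputN_of_published₅`, T6PeriodInput5) takes the two archimedean (1,1)-places of
each side Bergman-explicit: `(XA XB : N43Places.BergmanPlaces)` with `hxA : M.sA.d43 = XA.toPlaces`.
Its joint toy therefore needs an `NSide` whose `d43` IS `N43Toy.bergmanToy.toPlaces` — and whose Eischen–Liu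
binders, stated on the N4.1 datum's archimedean factors `d41.Lv (Sum.inr j)`, still hold. This file exhibits
that side with NO change to t6-p5's N4.1 datum: `bergmanNSide := { N42ToyNSide.toyNSide with
d43 := N43Toy.bergmanToy.toPlaces }`. The Bergman toy's `L`-factors are, BY DEFINITION, the N4.3 toys' own
(`N43Toy.bergmanU11.Lfac := N43Toy.toyU11.Lfac`, and `explicitU2`'s is `toyU2`'s), which are exactly the
real-place factors `N42ToyNSide.toyLvArch j` of t6-p5's `toyD41` — so every Eischen–Liu binder of the v5
theorem holds on `bergmanNSide` by `rfl`, the two Rühl (A-2f) binders are `N43Toy.bergmanU11_A2f`, the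
`[EX]` binder `hx` is `rfl`, and every N4.1 / N4.2 lemma of t6-p5 on `toyD41` / `toyFinitePlaces` applies
unchanged (`bergmanNSide.d41 = toyD41`, `bergmanNSide.d42 = toyFinitePlaces`, both `rfl`). No
re-normalisation of `toyD41` is needed (the lead's STATUS l. 11168 (3) question to t6-p5 is answered in the
negative: the datum already carries the Bergman factors).

What is proved here: the five display binders of v5's N4.3 slots on `bergmanNSide` (`bergmanNSide_EL₁`,
`_A2f₂`, `_EL₂`, `_A2f₃`, `_EL₃`), the three «obvious» GQT bridges (`bergmanNSide_conj11_5`), the side's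
archimedean non-vanishing (`bergmanNSide_archNonvanishing`, through `BergmanPlaces.N43_places_bergman_withLfac`
— no interface binder), `(H_loc)` and N4's conclusion on the side (`bergmanNSide_N4`), and the v5 consumer
form `bergmanNSide_N43_places_withLfac_of_eq`. Axioms: {propext, Classical.choice, Quot.sound}. §8(d): uses an
L-value-free non-vanishing device: NO.
-/

namespace Summit.Ventures.HodgeRepro2.T6

namespace N43Toy

open N42ToyNSide

/-- The toy N4 side for the M2 v5 carrier: t6-p5's consistent side `N42ToyNSide.toyNSide` (the N4.2 toy
`toyFinitePlaces`, the N4.1 toy datum `toyD41` with `L = ∏_v L_v` and the N4.3 toys' Eischen–Liu factors at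
the real places) with its N4.3 places replaced by the Bergman-explicit toy bundle `bergmanToy.toPlaces`;
`d41`, `d42` and the compat field `theta_fin` are unchanged. -/
noncomputable def bergmanNSide : NSide :=
  { N42ToyNSide.toyNSide with d43 := bergmanToy.toPlaces }

/-- The N4.2 datum of the side is t6-p5's toy. -/
theorem bergmanNSide_d42 : bergmanNSide.d42 = N42Toy.toyFinitePlaces := rfl

/-- The N4.3 places of the side are the Bergman toy bundle — the `[EX]` binder `hx` of v5, by `rfl`. -/
theorem bergmanNSide_d43 : bergmanNSide.d43 = bergmanToy.toPlaces := rfl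

/-- The N4.1 datum of the side is t6-p5's `toyD41`, unchanged. -/
theorem bergmanNSide_d41 : bergmanNSide.d41 = toyD41 := rfl

/-- The real-place factors of the side's N4.1 datum are the N4.3 toys' `L`-factors. -/
theorem bergmanNSide_Lv_inr (j : Fin 3) : bergmanNSide.d41.Lv (Sum.inr j) = toyLvArch j := rfl

/-! ## The five display binders of v5's N4.3 slots, on the side -/

/-- Eischen–Liu at the compact place τ′₁ (weight (0, 0; –), twist 0), stated on `d41.Lv (Sum.inr 0)` as in
v5: the factor is `toyU2.Lfac`, which is the Γ_ℂ-product by definition. -/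
theorem bergmanNSide_EL₁ :
    Hyp.EischenLiu2024_Sec2_2 2 0 bergmanNSide.d43.τ₁ bergmanNSide.d43.ν₁ bergmanNSide.d43.r₁
      (bergmanNSide.d41.Lv (Sum.inr 0)) :=
  fun _ => rfl

/-- Rühl's (A-2f) at τ′₂ of the side: the Bergman toy. -/
theorem bergmanNSide_A2f₂ : Hyp.Ruhl1970_A2f bergmanNSide.d43.d₂ := bergmanU11_A2f

/-- Eischen–Liu at τ′₂ (weight (0; 0), twist 0) on `d41.Lv (Sum.inr 1)`: the factor is `toyU11.Lfac`. -/
theorem bergmanNSide_EL₂ :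
    Hyp.EischenLiu2024_Sec2_2 1 1 bergmanNSide.d43.τ₂ bergmanNSide.d43.ν₂ bergmanNSide.d43.r₂
      (bergmanNSide.d41.Lv (Sum.inr 1)) :=
  fun _ => rfl

/-- Rühl's (A-2f) at τ′₃ of the side: the Bergman toy. -/
theorem bergmanNSide_A2f₃ : Hyp.Ruhl1970_A2f bergmanNSide.d43.d₃ := bergmanU11_A2f

/-- Eischen–Liu at τ′₃ (weight (0; 0), twist 0) on `d41.Lv (Sum.inr 2)`: the factor is `toyU11.Lfac`. -/
theorem bergmanNSide_EL₃ :
    Hyp.EischenLiu2024_Sec2_2 1 1 bergmanNSide.d43.τ₃ bergmanNSide.d43.ν₃ bergmanNSide.d43.r₃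
      (bergmanNSide.d41.Lv (Sum.inr 2)) :=
  fun _ => rfl

/-- The «obvious» direction of GQT Conj. 11.5 at a real place of the side (`toyD41.thetaNonzero ≡ True`),
for any archimedean datum `𝒟` — in particular for the re-pointed `(bergmanNSide.d43.withLfac …).dⱼ`
of v5's `hB₁ hB₂ hB₃`. -/
theorem bergmanNSide_conj11_5 {H : Type*} [MeasurableSpace H]
    {P : Matrix (Fin 2) (Fin 2) ℂ → Prop} (𝒟 : ArchDoublingDatum H P) (j : Fin 3) :
    Hyp.GQT2014_Conj11_5_obvious 𝒟 bergmanNSide.d41 (Sum.inr j) :=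
  fun _ => trivial

/-! ## N4.3 and N4 on the side -/

/-- THEOREM N4.3 on the side in the NSide (re-pointed) form, with no interface binder: the Bergman bundle's
`N43_places_bergman_withLfac` at the side's own archimedean factors. -/
theorem bergmanNSide_N43_places :
    (∀ j : Fin 3,
        0 < ((bergmanNSide.d43.withLfac fun j => bergmanNSide.d41.Lv (Sum.inr j)).zetaAt j).re) ∧
      (bergmanNSide.d43.withLfac fun j => bergmanNSide.d41.Lv (Sum.inr j)).ArchNonvanishing :=
  bergmanToy.N43_places_bergman_withLfac _ bergmanNSide_EL₁ bergmanNSide_A2f₂ bergmanNSide_EL₂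
    bergmanNSide_A2f₃ bergmanNSide_EL₃

/-- The side's archimedean non-vanishing (`NSide.ArchNonvanishing`). -/
theorem bergmanNSide_archNonvanishing : bergmanNSide.ArchNonvanishing :=
  bergmanNSide_N43_places.2

/-- The v5 consumer form on the side: `N43_places_withLfac_of_eq` with `hx = rfl`. -/
theorem bergmanNSide_N43_places_withLfac_of_eq :
    (∀ j : Fin 3,
        0 < ((bergmanNSide.d43.withLfac fun j => bergmanNSide.d41.Lv (Sum.inr j)).zetaAt j).re) ∧
      (bergmanNSide.d43.withLfac fun j => bergmanNSide.d41.Lv (Sum.inr j)).ArchNonvanishing :=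
  bergmanToy.N43_places_withLfac_of_eq _ rfl _ bergmanNSide_EL₁ bergmanNSide_A2f₂ bergmanNSide_EL₂
    bergmanNSide_A2f₃ bergmanNSide_EL₃

/-- `(H_loc)` on the side: t6-p5's `toyNSide_hloc`, the N4.1 datum being the same `toyD41`. -/
theorem bergmanNSide_hloc : bergmanNSide.d41.Hloc := toyNSide_hloc

/-- README §10.5(ii)(d) for the N4 side of the v5 carrier: N4's conclusion — (R1) and (H_loc) in N4.1's
words, and the archimedean non-vanishing — holds on `bergmanNSide`. -/
theorem bergmanNSide_N4 : bergmanNSide.R1AndHloc ∧ bergmanNSide.ArchNonvanishing :=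
  ⟨⟨toyD41_N41.1, bergmanNSide_hloc⟩, bergmanNSide_archNonvanishing⟩

end N43Toy

end Summit.Ventures.HodgeRepro2.T6
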